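import Summits.QuantumFields.YangMills.Theorems.AllWindowsColdBoxBoxHighLineTiltCum5SizesMuSetU
import Summits.QuantumFields.YangMills.Theorems.AllWindowsColdBoxBoxHighLineTiltThirdOrderCutSet

/-!
# U5 step (e5′) ON THE CUT SET in β-LETTERS — `|Cov₁ − Cov₀ − κ₃,₀ − κ₄,₀/2| ≤ K/6` over `μ_{D′}` with `K` = the discharged κ₅′ size, whole HIGH window
# (planner ym-idea-2 g18's ruling 2026-08-30T00:19:54Z «CUT of record», binder shape 00:34:10Z; `ASSEMBLY-U5.md` §3 (D′)/(E′); LINE-20 U5 ⟨stmt-QuantumFields-24336⟩)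

Width seat `ym-line-sfw-p2-w5` (prover-ym-line-sfw-p2-w5-g24-0).  One-line composition, BY NAME, of w2 g33's ✓13u³′
`GaussNormalForm.abs_tiltCov_sub_sub_tiltCum3_sub_half_tiltCum4_le_muSet_chartPlaqCost` (third-order Taylor of the tilted covariance over `μ_{D′}` for a GENERAL
measurable `D′`, `sup_{D′}|tiltU| ≤ 2`, mass defect `τ ≤ 1/2`) with this seat's ✓`exists_beta0_abs_tiltCum5_muSet_le` (κ₅′ in β-letters, `B = 2`; mass via ✓`GaussRestrict.half_le_gaussAvg_indicator`):

* ★★★ `GaussNormalForm.exists_beta0_abs_tiltCov_third_order_le_muSet` — for `0 ≤ θ`, `0 < κ₃`, `4θ + 4κ₃ < 1`, `2θ + 5κ₃ < 1` (e.g. the exponent point of record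
  `κ₃ = 1/8 − θ/4`, every `θ < 1/10`): `∃ C ≥ 0, m, β₀ ≥ 1, ∀ β ≥ β₀, ∀ H, 1 ≤ H ≤ β^θ + 1, ∀ D′` measurable `⊆ smallField H s` (`s = β^{−1/2+κ₃}`),
  `sup_{D′}|tiltU| ≤ 2 → ∀ τ, E₀[1 − 1_{D′}] ≤ τ → τ ≤ 1/2 → ∀ x y,`
  `|tiltCov μ_{D′} U 1 c_x c_y − tiltCov μ_{D′} U 0 c_x c_y − tiltCum3 μ_{D′} U 0 c_x c_y − tiltCum4 μ_{D′} U 0 c_x c_y / 2| ≤ C·(1+log H)^m·(((1+log H)²/β² + s³/(β√β))·(H⁶/(β√β)))/6`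
  (`C` absorbs `e^{8}`).  The instance of record: `D′ = smallField s ∖ E_cubic`, `sup ≤ 2` = w4's ✓`…TiltSupBoundsCubicCut`, `τ` = w2's ✓`gaussAvg_one_sub_indicator_cutSet_le`.

What the U5 assembler still supplies: `Cov₀`, `κ₃,₀`, `κ₄,₀` over `μ_{D′}` EXACTLY (w3 g41 K3′, LEAD g78 K4′ with fcl-p3 g27's transfers) and the FP-side `t = 1` glue (w2).
Everything proved; no definitions; standard axioms.  HONEST LABEL: U5 prep, helper-grade; U5 ⟨24336⟩ UNSTAFFED/OPEN, ⟨24004⟩ OPEN; route AllWindowsColdBox DRAFT;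
no crux, rung or summit is proved; **the Yang–Mills mass gap is NOT proved by this file; no summit is proved by a line.**
-/

set_option autoImplicit false

noncomputable section

open MeasureTheory Set Real
open Literature.Probability.LatticeModels (Site)

namespace Summit.QuantumFields.YangMills.Theorems.AllWindowsColdBoxBoxHighLine

namespace GaussNormalForm

/-- ★★★ **U5's step (e5′) on the CUT set in β-letters** (`U = tiltU β H`, `c_z = chartPlaqCost H z 1 2`, `s = β^{−1/2+κ₃}`,
`μ_{D′} = (volume.restrict D′).withDensity (ofReal ∘ gaussWeight β H)`; hypotheses: `sup_{D′}|U| ≤ 2` and the mass defect `E₀[1 − 1_{D′}] ≤ τ ≤ 1/2`). -/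
theorem exists_beta0_abs_tiltCov_third_order_le_muSet {θ κ₃ : ℝ} (hθ : 0 ≤ θ) (hκ0 : 0 < κ₃) (h44 : 4 * θ + 4 * κ₃ < 1) (h25 : 2 * θ + 5 * κ₃ < 1) :
    ∃ C : ℝ, ∃ m : ℕ, 0 ≤ C ∧ ∃ β₀ : ℝ, 1 ≤ β₀ ∧ ∀ β : ℝ, β₀ ≤ β → ∀ H : ℕ, 1 ≤ H → (H : ℝ) ≤ β ^ θ + 1 →
      ∀ D : Set (LandauFree H → E3), MeasurableSet D → D ⊆ smallField H (β ^ (-1 / 2 + κ₃)) → (∀ a ∈ D, |tiltU β H a| ≤ 2) →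
      ∀ τ : ℝ, gaussAvg β H (fun a => 1 - D.indicator (fun _ => (1 : ℝ)) a) ≤ τ → τ ≤ 1 / 2 → ∀ (x y : Site 4),
        |Tilt.tiltCov (((volume : Measure (LandauFree H → E3)).restrict D).withDensity fun a => ENNReal.ofReal (gaussWeight β H a))
              (tiltU β H) 1 (chartPlaqCost H x 1 2) (chartPlaqCost H y 1 2) -
            Tilt.tiltCov (((volume : Measure (LandauFree H → E3)).restrict D).withDensity fun a => ENNReal.ofReal (gaussWeight β H a))
              (tiltU β H) 0 (chartPlaqCost H x 1 2) (chartPlaqCost H y 1 2) -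
            Tilt.tiltCum3 (((volume : Measure (LandauFree H → E3)).restrict D).withDensity fun a => ENNReal.ofReal (gaussWeight β H a))
              (tiltU β H) 0 (chartPlaqCost H x 1 2) (chartPlaqCost H y 1 2) -
            Tilt.tiltCum4 (((volume : Measure (LandauFree H → E3)).restrict D).withDensity fun a => ENNReal.ofReal (gaussWeight β H a))
              (tiltU β H) 0 (chartPlaqCost H x 1 2) (chartPlaqCost H y 1 2) / 2| ≤
          C * (1 + Real.log H) ^ m *
            (((1 + Real.log H) ^ 2 / β ^ 2 + (β ^ (-1 / 2 + κ₃)) ^ 3 / (β * Real.sqrt β)) * ((H : ℝ) ^ 6 / (β * Real.sqrt β))) / 6 := by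
  obtain ⟨C, m, hC0, β₀, hβ₀, hK⟩ := exists_beta0_abs_tiltCum5_muSet_le hθ hκ0 h44 h25
  refine ⟨C * Real.exp (4 * 2), m, by positivity, β₀, hβ₀, fun β hβ H hH hHu D hDm hDs hU2 τ hτ hτ2 x y => ?_⟩
  have hβ0 : 0 < β := lt_of_lt_of_le one_pos (hβ₀.trans hβ)
  exact abs_tiltCov_sub_sub_tiltCum3_sub_half_tiltCum4_le_muSet_chartPlaqCost hβ0 hDm hτ hτ2 hU2 x y
    (hK β hβ H hH hHu D hDm hDs 2 (by norm_num) hU2 (GaussRestrict.half_le_gaussAvg_indicator hβ0 hDm hτ hτ2) x y)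

end GaussNormalForm

end Summit.QuantumFields.YangMills.Theorems.AllWindowsColdBoxBoxHighLine

end
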